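import Summits.AtomisticToContinuum.FouriersLaw.Theorems.PhononMeanFreePathIncoherentChannelTwoHorizonsCrux
import Summits.AtomisticToContinuum.FouriersLaw.Theorems.PhononMeanFreePathKuboFormFouriersLaw
import Summits.AtomisticToContinuum.FouriersLaw.Theorems.IncoherentChannel.Negative.LoadBearing

/-!
# Line census for `two-horizons-forecast-loss`: under the ENGINE alone the crux IS the conjunct

Route `PhononMeanFreePath`, crux `IncoherentChannel` (stmt-AtomisticToContinuum-11811), line lead c1.

The line's registered skeleton (`Cruxes/IncoherentChannel/Lines/two_horizons_forecast_loss.lean`) has two open stubs: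
the ENGINE `stub_forecastLoss` (the `N`-uniform forecast-loss envelope `S_N(t) = ‖K_t p_N‖²_{L²(μ₀)} ≤ C(1+t)^{−α}`,
`α > 2`) and the TRANSPORT CORE `stub_varianceLimit`. This file records, kernel-checked and with every hypothesis
displayed, what the engine alone buys — composing four landed, unconditional facts:

* `coherentDephasing_of_forecastLoss` (TwoHorizonsMean): engine ⇒ the rank-2 crux `CoherentDephasing` (11810) by name;
* `Negative.LoadBearing.incoherentChannel_iff_fouriersLaw`: under `NessUnique`, `BoundaryKubo`, `CoherentDephasing` the
  crux `↔ FouriersLaw`;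
* `NessUnique_holds` (route file) and `PhononMeanFreePathBoundaryKubo.boundaryKubo_proof` (11812): both siblings are theorems.

Hence `incoherentChannel_iff_fouriersLaw_of_forecastLoss`: GIVEN THE ENGINE (a hypothesis, never asserted), the crux
`IncoherentChannel` is EQUIVALENT to the sub-problem conjunct `FouriersLaw` (Bonetto–Lebowitz–Rey-Bellet 2000, §5.3
eq. (33) for `pinnedChain`; open for every Hamiltonian anharmonic bulk). Read together with the landed certificate for
the second stub (`varianceLimit_iff_fouriersLaw_of_forecastLoss`, VarianceLimitReduction): once the engine is granted,
the line's remaining stub, the crux, and the conjunct are one and the same statement — the line cannot close the crux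
short of Fourier's law, and conversely a proof of the engine turns ANY proof of Fourier's law for this chain into the
crux and closes `CoherentDephasing` outright. The unconditional bookkeeping form (no engine) is
`incoherentChannel_and_coherentDephasing_iff`.

No definition, no `sorry`, axioms standard; every theorem is conditional on its displayed hypotheses only.
-/

noncomputable section

open MeasureTheory Set Filter Topology

namespace Summit.AtomisticToContinuum.FouriersLaw.Theorems.PhononMeanFreePath

open Literature.MathematicalPhysics.KineticTheory.HeatConduction
open Summit.AtomisticToContinuum.FouriersLaw.Theses.PhononMeanFreePath

/-- **Under the engine alone, the crux IS the conjunct.** Given the `N`-uniform forecast-loss envelope `h₁` (the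
statement of the registered stub `stub_forecastLoss`, a HYPOTHESIS), `IncoherentChannel ↔ FouriersLaw`: the envelope
yields `CoherentDephasing` (`coherentDephasing_of_forecastLoss`), and with the proved siblings `NessUnique_holds`,
`boundaryKubo_proof` the landed Negative lemma `LoadBearing.incoherentChannel_iff_fouriersLaw` applies. [folklore] -/
theorem incoherentChannel_iff_fouriersLaw_of_forecastLoss : (∀ ω₂ lam β γ : ℝ, 0 < ω₂ → 0 < lam → 0 < β → 0 < γ → ∀ T : ℝ, 0 < T → ∃ C α : ℝ, 2 < α ∧ ∀ (N : ℕ) (t : ℝ), 0 ≤ t → fnorm ω₂ lam β γ T N t ≤ C * (1 + t) ^ (-α)) → (Summit.AtomisticToContinuum.FouriersLaw.Theses.PhononMeanFreePath.IncoherentChannel ↔ _root_.FouriersLaw) := by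
  intro h₁
  exact Summit.AtomisticToContinuum.FouriersLaw.Theorems.IncoherentChannel.Negative.LoadBearing.incoherentChannel_iff_fouriersLaw
    NessUnique_holds Summit.AtomisticToContinuum.FouriersLaw.Theorems.PhononMeanFreePathBoundaryKubo.boundaryKubo_proof
    (coherentDephasing_of_forecastLoss h₁)

/-- **Engine + Fourier's law ⇒ the crux** (the usable direction, spelled out): a proof of the envelope turns any proof
of `FouriersLaw` for the pinned anharmonic chain into `IncoherentChannel`. [folklore] -/
theorem incoherentChannel_of_forecastLoss_of_fouriersLaw
    (h₁ : ∀ ω₂ lam β γ : ℝ, 0 < ω₂ → 0 < lam → 0 < β → 0 < γ → ∀ T : ℝ, 0 < T →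
      ∃ C α : ℝ, 2 < α ∧ ∀ (N : ℕ) (t : ℝ), 0 ≤ t → fnorm ω₂ lam β γ T N t ≤ C * (1 + t) ^ (-α))
    (hF : _root_.FouriersLaw) : IncoherentChannel :=
  (incoherentChannel_iff_fouriersLaw_of_forecastLoss h₁).2 hF

/-- **Unconditional bookkeeping (no engine):** with both siblings proved, `IncoherentChannel ∧ CoherentDephasing` and
`FouriersLaw ∧ CoherentDephasing` are the same statement — the route's `closes` one way, the landed converse
`LoadBearing.incoherentChannel_iff_fouriersLaw` the other. What separates the crux from the conjunct is exactly the
rank-2 crux `CoherentDephasing`, which the engine supplies. [folklore] -/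
theorem incoherentChannel_and_coherentDephasing_iff :
    (IncoherentChannel ∧ CoherentDephasing) ↔ (_root_.FouriersLaw ∧ CoherentDephasing) := by
  constructor
  · rintro ⟨hB, hA⟩
    exact ⟨(Summit.AtomisticToContinuum.FouriersLaw.Theorems.IncoherentChannel.Negative.LoadBearing.incoherentChannel_iff_fouriersLaw
      NessUnique_holds Summit.AtomisticToContinuum.FouriersLaw.Theorems.PhononMeanFreePathBoundaryKubo.boundaryKubo_proof hA).1 hB, hA⟩
  · rintro ⟨hF, hA⟩
    exact ⟨(Summit.AtomisticToContinuum.FouriersLaw.Theorems.IncoherentChannel.Negative.LoadBearing.incoherentChannel_iff_fouriersLaw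
      NessUnique_holds Summit.AtomisticToContinuum.FouriersLaw.Theorems.PhononMeanFreePathBoundaryKubo.boundaryKubo_proof hA).2 hF, hA⟩

end Summit.AtomisticToContinuum.FouriersLaw.Theorems.PhononMeanFreePath

end
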